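import Summits.NavierStokesRegularity.FluidComputer.PalasekTowerGermHostSuperposedFreeRun
import Summits.NavierStokesRegularity.FluidComputer.PalasekTowerTinyBlobStrainExplicit
import Summits.NavierStokesRegularity.NavierStokesRegularity.Theorems.PalasekTowerBreakdownEpisodeBaseStrictSlotFreeRun

/-!
# `EpisodeBase` (crux stmt-NavierStokesRegularity-19179) from TWO SEPARATE FREE RUNS — a tame carrier run and an
# amplifier run meeting the first-window letter in its own frame — BY NAME (the dynamic companion rule)

Cell `ns-blowup`, seat `ns-blowup-ecbridge-3` (g7; D-0074 GROUP C «BRIDGE SUPPORT», lineage `host_preparation`).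
Route `PalasekTowerBreakdown`, crux `EpisodeBase`, line `slot` v5. Composition of the SUPERPOSITION DOOR
(`Germ.LevelZeroData.exists_superposed_freeRun`, FluidComputer, this seat: for `‖c‖ ≥ r₀` chosen in the
kernel the composite `U₁ + W(· − c)` is a strict-slot filler whose free run meets the letter with half the
margin) with the FREE-RUN DOOR at the strict slot
(`palasekTowerBreakdown_episodeBase_of_levelZeroData_freeRun`, g6). LABEL: E–C typing (KERNEL: theorems only;
`--supports` stmt-NavierStokesRegularity-19179). WHAT THIS IS NOT: not Navier–Stokes evidence — no free run
meeting the letter is exhibited; nothing about `RungG 1` or blow-up is asserted.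

* `palasekTowerBreakdown_episodeBase_of_superposed_freeRuns` — ANY strict-slot carrier `U₁`
  (`Germ.LevelZeroData U₁ ρ₁`) whose free run stays under the cap `(5/3)Y₁ − η`, plus ANY smooth compactly
  supported divergence-free amplifier `W` of speed `< Y₀` whose OWN free run stays under the cap and meets the
  three level-`1` faces with margin `η` at `Host.τfirst` inside its own ball `‖x‖ ≤ R` ⟹ `EpisodeBase`.
* `palasekTowerBreakdown_episodeBase_of_amplifier_freeRun` — the same with the carrier FIXED to the numeric
  kernel inhabitant `strictTinyProfile a`, `0 < a ≤ 11/648` (`Germ.levelZeroData_strictTinyProfile_of_le`):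
  the level-`0` register gadgets are no longer a condition on the mechanism `W`.

So the crux's MODEL-facing letter reads: ONE free classical finite-energy Navier–Stokes run (`ν = 1`) of a
speed-`< Y₀` compactly supported divergence-free datum `W` reaching, at `Host.τfirst`, speed `≥ Y₁ + η`,
gradient `≥ A₁ + η` and an `N₁`-core loop of circulation `≥ N₁^{β−2} + η` near `W`, under the cap
`(5/3)Y₁ − η` — together with ONE free run of the fixed tiny carrier staying under the cap (a design-independent
obligation). References: S. Palasek, arXiv:2605.13827 §4 [cite: Palasek2026ElementaryModel, §4]; T. Tao,
Anal. PDE 6 (2013), Thm. 5.4 [cite: Tao2011, Thm. 5.4 (ii)+(iv)].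
-/

noncomputable section

-- `Summit.<Summit>.<Problem>` is the tree's mandated summit-side namespace (CONVENTIONS §2); for this
-- single-conjunct summit the two coincide, so the duplicate is deliberate.
set_option linter.dupNamespace false

namespace Summit.NavierStokesRegularity.NavierStokesRegularity.Theorems

open Set Function MeasureTheory Metric
open scoped ENNReal ContDiff
open Summit.NavierStokesRegularity.NavierStokesRegularity.Theses
open Summit.NavierStokesRegularity.FluidComputer.PalasekTowerClayBridge
open Summit.NavierStokesRegularity.FluidComputer.PalasekTowerClayBridge.Germ
open Literature.Analysis.FluidPDE

/-- **`EpisodeBase` FROM A TAME CARRIER RUN AND AN AMPLIFIER RUN (dynamic companion rule, by name).** Let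
`h₁ : Germ.LevelZeroData U₁ ρ₁` be a strict-slot carrier with ONE classical finite-energy free run (`ν = 1`)
`(v₁, q₁)` on `[1, Host.τfirst]` from `v₁ 1 = U₁` below `(5/3) Y₁ − η`; let `W` be smooth, divergence free,
`tsupport W ⊆ B̄(0, R)` (`R ≥ 0`), of speed `< Y₀`, with ONE classical finite-energy free run `(v₂, q₂)` on
`[1, Host.τfirst]` from `v₂ 1 = W` below `(5/3) Y₁ − η` showing at `Host.τfirst`, inside `‖x‖ ≤ R`:
`Y₁ + η ≤ ‖v₂‖`, `A₁ + η ≤ ‖Dv₂‖`, and an `N₁`-core loop of circulation `≥ N₁^{β−2} + η` (`η > 0`). Then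
`EpisodeBase`: far enough apart (`‖c‖ ≥ r₀`, chosen in the kernel) the composite `U₁ + W(· − c)` is a
strict-slot filler whose free run meets the letter with margin `η/2` (`LevelZeroData.exists_superposed_freeRun`),
and the free-run door closes the crux. [cite: Palasek2026ElementaryModel, §4] [cite: Tao2011, Thm. 5.4 (ii)+(iv)] -/
theorem palasekTowerBreakdown_episodeBase_of_superposed_freeRuns
    {U₁ W : EuclideanSpace ℝ (Fin 3) → EuclideanSpace ℝ (Fin 3)} {ρ₁ R : ℝ} (h₁ : LevelZeroData U₁ ρ₁)
    (hW : ContDiff ℝ ∞ W) (hdivW : VectorCalculus.IsDivFree W) (hWsupp : tsupport W ⊆ closedBall 0 R)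
    (hWlt : ∀ x, ‖W x‖ < TowerRates.wide.Y 0) (hR : 0 ≤ R)
    {v₁ : ℝ → EuclideanSpace ℝ (Fin 3) → EuclideanSpace ℝ (Fin 3)} {q₁ : ℝ → EuclideanSpace ℝ (Fin 3) → ℝ}
    (hv₁ : IsClassicalNSSolutionOn (Icc 1 Host.τfirst) 1 0 v₁ q₁) (hv₁1 : v₁ 1 = U₁)
    (hv₁E : ∃ C : ℝ≥0∞, C < ⊤ ∧ ∀ t ∈ Icc (1 : ℝ) Host.τfirst, ∫⁻ x, ‖v₁ t x‖ₑ ^ 2 ≤ C)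
    {v₂ : ℝ → EuclideanSpace ℝ (Fin 3) → EuclideanSpace ℝ (Fin 3)} {q₂ : ℝ → EuclideanSpace ℝ (Fin 3) → ℝ}
    (hv₂ : IsClassicalNSSolutionOn (Icc 1 Host.τfirst) 1 0 v₂ q₂) (hv₂1 : v₂ 1 = W)
    (hv₂E : ∃ C : ℝ≥0∞, C < ⊤ ∧ ∀ t ∈ Icc (1 : ℝ) Host.τfirst, ∫⁻ x, ‖v₂ t x‖ₑ ^ 2 ≤ C)
    {η : ℝ} (hη : 0 < η)
    (hcap₁ : ∀ t ∈ Icc (1 : ℝ) Host.τfirst, ∀ x, ‖v₁ t x‖ ≤ 5 / 3 * TowerRates.wide.Y 1 - η)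
    (hcap₂ : ∀ t ∈ Icc (1 : ℝ) Host.τfirst, ∀ x, ‖v₂ t x‖ ≤ 5 / 3 * TowerRates.wide.Y 1 - η)
    (hspeed : ∃ x, ‖x‖ ≤ R ∧ TowerRates.wide.Y 1 + η ≤ ‖v₂ Host.τfirst x‖)
    (hstrain : ∃ x, ‖x‖ ≤ R ∧ TowerRates.wide.A 1 + η ≤ ‖fderiv ℝ (v₂ Host.τfirst) x‖)
    (hcore : ∃ (x : EuclideanSpace ℝ (Fin 3)) (γ : ℝ → EuclideanSpace ℝ (Fin 3)),
      ‖x‖ ≤ R ∧ ContDiff ℝ 1 γ ∧ γ 0 = γ 1 ∧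
      (∀ s ∈ Icc (0 : ℝ) 1, γ s ∈ closedBall x (1 / TowerRates.wide.N 1)) ∧
      (∀ s ∈ Icc (0 : ℝ) 1, ‖deriv γ s‖ ≤ 8 * Real.pi / TowerRates.wide.N 1) ∧
      TowerRates.wide.N 1 ^ (TowerRates.wide.β - 2) + η ≤ circulation (v₂ Host.τfirst) γ) :
    PalasekTowerBreakdown.EpisodeBase := by
  obtain ⟨r₀, hr₀⟩ := h₁.exists_superposed_freeRun hW hdivW hWsupp hWlt hR hv₁ hv₁1 hv₁E hv₂ hv₂1 hv₂E hη
    hcap₁ hcap₂ hspeed hstrain hcore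
  -- a translation vector of length `≥ r₀`
  obtain ⟨c, hc'⟩ := exists_norm_eq (EuclideanSpace ℝ (Fin 3)) (le_max_right r₀ 0)
  have hc : r₀ ≤ ‖c‖ := by rw [hc']; exact le_max_left _ _
  obtain ⟨hLZ, u, p, hu, hu1, huE, hcap, hsp, hst, hco⟩ := hr₀ c hc
  exact palasekTowerBreakdown_episodeBase_of_levelZeroData_freeRun hLZ hu hu1 huE (half_pos hη) hcap hsp hst hco

/-- **`EpisodeBase` FROM AN AMPLIFIER RUN AND ONE TAME RUN OF THE NUMERIC TINY CARRIER.** The carrier is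
FIXED to the kernel inhabitant `strictTinyProfile a`, `0 < a ≤ 11/648`, of the strict slot
(`Germ.levelZeroData_strictTinyProfile_of_le`, radius `7`): given ONE classical finite-energy free run of
`strictTinyProfile a` on `[1, Host.τfirst]` below `(5/3) Y₁ − η`, EVERY smooth compactly supported
divergence-free `W` of speed `< Y₀` whose own free run stays below the cap and meets the three level-`1`
faces with margin `η` near `W` yields `EpisodeBase` — the level-`0` register gadgets are no longer a
condition on the mechanism. [cite: Palasek2026ElementaryModel, §4] [cite: Tao2011, Thm. 5.4 (ii)+(iv)] -/
theorem palasekTowerBreakdown_episodeBase_of_amplifier_freeRun {a : ℝ} (ha : 0 < a) (ha' : a ≤ 11 / 648)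
    {W : EuclideanSpace ℝ (Fin 3) → EuclideanSpace ℝ (Fin 3)} {R : ℝ}
    (hW : ContDiff ℝ ∞ W) (hdivW : VectorCalculus.IsDivFree W) (hWsupp : tsupport W ⊆ closedBall 0 R)
    (hWlt : ∀ x, ‖W x‖ < TowerRates.wide.Y 0) (hR : 0 ≤ R)
    {v₁ : ℝ → EuclideanSpace ℝ (Fin 3) → EuclideanSpace ℝ (Fin 3)} {q₁ : ℝ → EuclideanSpace ℝ (Fin 3) → ℝ}
    (hv₁ : IsClassicalNSSolutionOn (Icc 1 Host.τfirst) 1 0 v₁ q₁) (hv₁1 : v₁ 1 = strictTinyProfile a)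
    (hv₁E : ∃ C : ℝ≥0∞, C < ⊤ ∧ ∀ t ∈ Icc (1 : ℝ) Host.τfirst, ∫⁻ x, ‖v₁ t x‖ₑ ^ 2 ≤ C)
    {v₂ : ℝ → EuclideanSpace ℝ (Fin 3) → EuclideanSpace ℝ (Fin 3)} {q₂ : ℝ → EuclideanSpace ℝ (Fin 3) → ℝ}
    (hv₂ : IsClassicalNSSolutionOn (Icc 1 Host.τfirst) 1 0 v₂ q₂) (hv₂1 : v₂ 1 = W)
    (hv₂E : ∃ C : ℝ≥0∞, C < ⊤ ∧ ∀ t ∈ Icc (1 : ℝ) Host.τfirst, ∫⁻ x, ‖v₂ t x‖ₑ ^ 2 ≤ C)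
    {η : ℝ} (hη : 0 < η)
    (hcap₁ : ∀ t ∈ Icc (1 : ℝ) Host.τfirst, ∀ x, ‖v₁ t x‖ ≤ 5 / 3 * TowerRates.wide.Y 1 - η)
    (hcap₂ : ∀ t ∈ Icc (1 : ℝ) Host.τfirst, ∀ x, ‖v₂ t x‖ ≤ 5 / 3 * TowerRates.wide.Y 1 - η)
    (hspeed : ∃ x, ‖x‖ ≤ R ∧ TowerRates.wide.Y 1 + η ≤ ‖v₂ Host.τfirst x‖)
    (hstrain : ∃ x, ‖x‖ ≤ R ∧ TowerRates.wide.A 1 + η ≤ ‖fderiv ℝ (v₂ Host.τfirst) x‖)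
    (hcore : ∃ (x : EuclideanSpace ℝ (Fin 3)) (γ : ℝ → EuclideanSpace ℝ (Fin 3)),
      ‖x‖ ≤ R ∧ ContDiff ℝ 1 γ ∧ γ 0 = γ 1 ∧
      (∀ s ∈ Icc (0 : ℝ) 1, γ s ∈ closedBall x (1 / TowerRates.wide.N 1)) ∧
      (∀ s ∈ Icc (0 : ℝ) 1, ‖deriv γ s‖ ≤ 8 * Real.pi / TowerRates.wide.N 1) ∧
      TowerRates.wide.N 1 ^ (TowerRates.wide.β - 2) + η ≤ circulation (v₂ Host.τfirst) γ) :
    PalasekTowerBreakdown.EpisodeBase :=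
  palasekTowerBreakdown_episodeBase_of_superposed_freeRuns (levelZeroData_strictTinyProfile_of_le ha ha') hW
    hdivW hWsupp hWlt hR hv₁ hv₁1 hv₁E hv₂ hv₂1 hv₂E hη hcap₁ hcap₂ hspeed hstrain hcore

end Summit.NavierStokesRegularity.NavierStokesRegularity.Theorems

end
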